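import Summits.HodgeConjecture.HodgeConjecture.Theorems.Ring2WeilCoverageWeilGramLevel48
import Summits.HodgeConjecture.HodgeConjecture.Theorems.Ring2WeilCoverageWeilGramTools
import Mathlib.Tactic.ComputeDegree
import HarnessLib

/-!
# Weil-type family coverage — THE COMPONENTS OF THE WEIL-TYPE `ℤ[ζ₄₈]`-EIGHTFOLDS, II: `K_d = ℚ(i)` (`s = √−1 = ζ¹² = i`): the principal-type form `(E_ξ, i)` — fifteen traces, the `8 × 8` Hankel matrix, `det a = 256 = 16² + 1·0²` by an LU certificate — RIGHT sign, SPLIT class (the YES row `(48, ℚ(i))`, W8.1.1)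

research route conditional on HC_CM; not a corollary; Q11.4-sentence-2 already refuted in dim ≥ 3.

Ring 2, WEIL-TYPE FAMILY-COVERAGE CENSUS (`HOME/WEIL-FAMILY-COVERAGE.md` `## b01`, block b01.36 (D) / b01.47–49; owner
ring2-b01), part 166 of the `Ring2WeilCoverage*` series; continues part 165 (`Ring2WeilCoverageWeilGramLevel48`: level
lemmas) with the tools of part 119 (`Ring2WeilCoverageWeilGramTools`: evaluation step, LU certificate rule).
For a skew `ζ′` and a skew `s` with `s² = −d`
part 82 (`Ring2WeilCoverageWeilGramCMPoint`) shows that the Gram matrix `Ψ = a + b√−d` of van Geemen's hermitian form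
`H = E(x, sy) + √−d E(x, y)`, `E = E_ζ′ = Tr_{K/ℚ}(ζ′xȳ)`, in a real frame is the rational matrix `a = (−Tr(ζ′s xᵢxⱼ))`,
`b = 0`, with `det a = (−2)^g N_{K⁺/ℚ}(ζ′s) disc(ω)`; for `n = 4` (EVEN) the split class is `Nm` itself and a `Φ`-positive
`ζ′` on a Weil-type (`(4,4)`) CM type has `(−1)⁴ det a = det a > 0` (part 92).

* §1 `ζ′s` reduced, the fifteen traces `Tr(ξ i θ^m)`, `m ≤ 14`, and the Gram datum: **`a = −(Tr(ξ i θ^{i+j}))`,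
  `det a = 256`** — POSITIVE, the right sign `(−1)⁴ det a > 0` for Weil signature `(4,4)`, and `256 = 16² + 1·0² ∈ Nm(ℚ(i)ˣ)`:
  the SPLIT class (part 170 `Ring2WeilCoverageWeilGramLevel48Principal` turns this into the census form for the YES
  row `(48, ℚ(i))`: invariance over the principal type, existence on every `ℚ(i)`-balanced `Φ`, class
  `splitDiscriminantClass 4 1`).  The determinant is certified by `P·a[σ] = U` (`decide`), part 119.

HONEST FRAMING as parts 82–154: kernel statements about traces in `ℚ(ζ₄₈)` and the rational Gram matrices `(a, b)` of
part 82 (hypotheses `ha`); the census ROW words are the reading of the class `[det a]` by [vG94 Lemma 5.2 (3), (5.4.1)];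
nothing about Hodge classes, `W_K`, general members or HC; `HC_CM` is used nowhere.  No `def`, no named fact, no `sorry`.
Certificates (Euler numerators `R`, cofactors, the LU data `P`, `U`, `σ`) produced by `work/py/geng.py` + `detcert.py` +
`allyes.py` (exact arithmetic, stdlib) and re-verified here by `linear_combination` / `decide`.

References: [cite: vanGeemen1994HodgeAV, Lemma 5.2 (2)–(4), 5.4 and (5.4.1)]; [cite: Shimura1998, §14.3 Prop. 4–5,
pp. 103–104]; [cite: NeukirchANT1999, Ch. III (2.4)] (Euler); census b01.36 / b01.47–49 (seat-derived).
-/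

noncomputable section

open Polynomial NumberField Module
open scoped nonZeroDivisors

namespace Summit.HodgeConjecture.Ring2WeilCoverage.WeilGramLevel48SqrtNegOne

open Literature.AlgebraicGeometry.VanGeemen1994 (weilField weilNormResidueGroup)
open Literature.AlgebraicGeometry.Motives (CMType normUnitsSubgroup)
open Literature.NumberTheory.ComplexMultiplication
open Summit.HodgeConjecture.Ring2WeilCoverage.WeilGramTools
open Summit.HodgeConjecture.Ring2WeilCoverage.WeilGramCMPoint
open Summit.HodgeConjecture.Ring2WeilCoverage.RealUnitNormHalfSystems (complexConj_eq_inv)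
open Summit.HodgeConjecture.Ring2WeilCoverage.CyclotomicPrincipalObstruction (complexConj_xi)
open Summit.HodgeConjecture.Ring2WeilCoverage.CyclotomicDifferent (isOfType_one_xi_top xi_ne_zero)
open Summit.HodgeConjecture.HodgeConjecture.Ring2.WeilCoverage (mk_neg_eq_split_of_odd mk_neg_ne_split_of_odd
  mk_eq_split_of_even mk_ne_split_of_even mem_normUnitsSubgroup_of_sq_add_mul_sq natCast_not_mem_normUnitsSubgroup_of_ramified)
open Summit.HodgeConjecture.HodgeConjecture.Ring2.Hypotheses (splitDiscriminantClass)
open Summit.HodgeConjecture.Ring2WeilCoverage.WeilGramLevel48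
variable {K : Type} [Field K] [NumberField K] {ζ : K}

/-! ### §1 The principal-type form `(E_ξ, i)`: fifteen traces, the `8 × 8` Hankel matrix, `det a = 256` -/

/-- **`ζ′s·Φ₍48₎′(ζ)` reduced**: `ζ′s = r(ζ)·Φ′(ζ)⁻¹` with `deg r < 16` for `ζ′ = ξ = ζ⁷/Φ₄₈′(ζ)`, `s = √−1 = ζ¹² = i` (certificate
`mod Φ_48`, `ζ^48 = 1`). research route conditional on HC_CM; not a corollary; Q11.4-sentence-2 already refuted in dim ≥ 3. [folklore] -/
theorem red_xi_sqrtNegOne (hζ : IsPrimitiveRoot ζ 48) :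
    (ζ ^ 7 * (aeval ζ (derivative (cyclotomic 48 ℚ)))⁻¹) * (ζ ^ 12) =
      (-ζ ^ 3 + ζ ^ 11) *
        (aeval ζ (derivative (cyclotomic 48 ℚ)))⁻¹ := by
  have hΦ := cyc_fortyEight hζ
  linear_combination ((aeval ζ (derivative (cyclotomic 48 ℚ)))⁻¹ * (ζ^3)) * hΦ

/-- `Tr(ζ′sθ^0) = 0` for `ζ′ = ξ = ζ⁷/Φ₄₈′(ζ)`, `s = √−1 = ζ¹² = i`, `θ = ζ + ζ⁻¹` (Euler evaluation). research route conditional on HC_CM; not a corollary; Q11.4-sentence-2 already refuted in dim ≥ 3. [folklore] -/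
theorem trace_xi_sqrtNegOne_zero [IsCyclotomicExtension {48} ℚ K] (hζ : IsPrimitiveRoot ζ 48) :
    Algebra.trace ℚ K ((ζ ^ 7 * (aeval ζ (derivative (cyclotomic 48 ℚ)))⁻¹) * (ζ ^ 12)) = 0 := by
  rw [trace_of_key₀ hζ (by decide : Nat.totient 48 = 15 + 1) (C (0 : ℚ) + C (0 : ℚ) * X + C (0 : ℚ) * X ^ 2 + C (-1 : ℚ) * X ^ 3 + C (0 : ℚ) * X ^ 4 + C (0 : ℚ) * X ^ 5 +
      C (0 : ℚ) * X ^ 6 + C (0 : ℚ) * X ^ 7 + C (0 : ℚ) * X ^ 8 + C (0 : ℚ) * X ^ 9 + C (0 : ℚ) * X ^ 10 +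
      C (1 : ℚ) * X ^ 11 + C (0 : ℚ) * X ^ 12 + C (0 : ℚ) * X ^ 13 + C (0 : ℚ) * X ^ 14 + C (0 : ℚ) * X ^ 15) (by compute_degree) (by
    rw [red_xi_sqrtNegOne hζ]
    simp only [map_add, map_mul, map_pow, aeval_C, aeval_X, eq_ratCast]
    push_cast
    ring)]
  norm_num [coeff_X_pow, coeff_X, coeff_C, coeff_one]

/-- `Tr(ζ′sθ^1) = 0` for `ζ′ = ξ = ζ⁷/Φ₄₈′(ζ)`, `s = √−1 = ζ¹² = i`, `θ = ζ + ζ⁻¹` (Euler evaluation). research route conditional on HC_CM; not a corollary; Q11.4-sentence-2 already refuted in dim ≥ 3. [folklore] -/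
theorem trace_xi_sqrtNegOne_one [IsCyclotomicExtension {48} ℚ K] (hζ : IsPrimitiveRoot ζ 48) :
    Algebra.trace ℚ K ((ζ ^ 7 * (aeval ζ (derivative (cyclotomic 48 ℚ)))⁻¹) * (ζ ^ 12) * (ζ + ζ⁻¹)) = 0 := by
  rw [trace_of_key₁ hζ (by decide : Nat.totient 48 = 15 + 1) (C (0 : ℚ) + C (0 : ℚ) * X + C (-1 : ℚ) * X ^ 2 + C (0 : ℚ) * X ^ 3 + C (-1 : ℚ) * X ^ 4 + C (0 : ℚ) * X ^ 5 +
      C (0 : ℚ) * X ^ 6 + C (0 : ℚ) * X ^ 7 + C (0 : ℚ) * X ^ 8 + C (0 : ℚ) * X ^ 9 + C (1 : ℚ) * X ^ 10 +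
      C (0 : ℚ) * X ^ 11 + C (1 : ℚ) * X ^ 12 + C (0 : ℚ) * X ^ 13 + C (0 : ℚ) * X ^ 14 + C (0 : ℚ) * X ^ 15) (by compute_degree) (by
    rw [red_xi_sqrtNegOne hζ]
    simp only [map_add, map_mul, map_pow, aeval_C, aeval_X, eq_ratCast]
    push_cast
    ring)]
  norm_num [coeff_X_pow, coeff_X, coeff_C, coeff_one]

/-- `Tr(ζ′sθ^2) = 0` for `ζ′ = ξ = ζ⁷/Φ₄₈′(ζ)`, `s = √−1 = ζ¹² = i`, `θ = ζ + ζ⁻¹` (Euler evaluation). research route conditional on HC_CM; not a corollary; Q11.4-sentence-2 already refuted in dim ≥ 3. [folklore] -/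
theorem trace_xi_sqrtNegOne_two [IsCyclotomicExtension {48} ℚ K] (hζ : IsPrimitiveRoot ζ 48) :
    Algebra.trace ℚ K ((ζ ^ 7 * (aeval ζ (derivative (cyclotomic 48 ℚ)))⁻¹) * (ζ ^ 12) * (ζ + ζ⁻¹) ^ 2) = 0 := by
  rw [trace_of_key hζ (by decide : Nat.totient 48 = 15 + 1) (C (0 : ℚ) + C (-1 : ℚ) * X + C (0 : ℚ) * X ^ 2 + C (-2 : ℚ) * X ^ 3 + C (0 : ℚ) * X ^ 4 + C (-1 : ℚ) * X ^ 5 +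
      C (0 : ℚ) * X ^ 6 + C (0 : ℚ) * X ^ 7 + C (0 : ℚ) * X ^ 8 + C (1 : ℚ) * X ^ 9 + C (0 : ℚ) * X ^ 10 +
      C (2 : ℚ) * X ^ 11 + C (0 : ℚ) * X ^ 12 + C (1 : ℚ) * X ^ 13 + C (0 : ℚ) * X ^ 14 + C (0 : ℚ) * X ^ 15) (by compute_degree) (by
    rw [red_xi_sqrtNegOne hζ]
    simp only [map_add, map_mul, map_pow, aeval_C, aeval_X, eq_ratCast]
    push_cast
    ring)]
  norm_num [coeff_X_pow, coeff_X, coeff_C, coeff_one]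

/-- `Tr(ζ′sθ^3) = 0` for `ζ′ = ξ = ζ⁷/Φ₄₈′(ζ)`, `s = √−1 = ζ¹² = i`, `θ = ζ + ζ⁻¹` (Euler evaluation). research route conditional on HC_CM; not a corollary; Q11.4-sentence-2 already refuted in dim ≥ 3. [folklore] -/
theorem trace_xi_sqrtNegOne_three [IsCyclotomicExtension {48} ℚ K] (hζ : IsPrimitiveRoot ζ 48) :
    Algebra.trace ℚ K ((ζ ^ 7 * (aeval ζ (derivative (cyclotomic 48 ℚ)))⁻¹) * (ζ ^ 12) * (ζ + ζ⁻¹) ^ 3) = 0 := by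
  rw [trace_of_key hζ (by decide : Nat.totient 48 = 15 + 1) (C (-1 : ℚ) + C (0 : ℚ) * X + C (-3 : ℚ) * X ^ 2 + C (0 : ℚ) * X ^ 3 + C (-3 : ℚ) * X ^ 4 + C (0 : ℚ) * X ^ 5 +
      C (-1 : ℚ) * X ^ 6 + C (0 : ℚ) * X ^ 7 + C (1 : ℚ) * X ^ 8 + C (0 : ℚ) * X ^ 9 + C (3 : ℚ) * X ^ 10 +
      C (0 : ℚ) * X ^ 11 + C (3 : ℚ) * X ^ 12 + C (0 : ℚ) * X ^ 13 + C (1 : ℚ) * X ^ 14 + C (0 : ℚ) * X ^ 15) (by compute_degree) (by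
    rw [red_xi_sqrtNegOne hζ]
    simp only [map_add, map_mul, map_pow, aeval_C, aeval_X, eq_ratCast]
    push_cast
    ring)]
  norm_num [coeff_X_pow, coeff_X, coeff_C, coeff_one]

/-- `Tr(ζ′sθ^4) = 2` for `ζ′ = ξ = ζ⁷/Φ₄₈′(ζ)`, `s = √−1 = ζ¹² = i`, `θ = ζ + ζ⁻¹` (Euler evaluation). research route conditional on HC_CM; not a corollary; Q11.4-sentence-2 already refuted in dim ≥ 3. [folklore] -/
theorem trace_xi_sqrtNegOne_four [IsCyclotomicExtension {48} ℚ K] (hζ : IsPrimitiveRoot ζ 48) :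
    Algebra.trace ℚ K ((ζ ^ 7 * (aeval ζ (derivative (cyclotomic 48 ℚ)))⁻¹) * (ζ ^ 12) * (ζ + ζ⁻¹) ^ 4) = 2 := by
  have hΦ := cyc_fortyEight hζ
  rw [trace_of_key hζ (by decide : Nat.totient 48 = 15 + 1) (C (0 : ℚ) + C (-4 : ℚ) * X + C (0 : ℚ) * X ^ 2 + C (-6 : ℚ) * X ^ 3 + C (0 : ℚ) * X ^ 4 + C (-4 : ℚ) * X ^ 5 +
      C (0 : ℚ) * X ^ 6 + C (-1 : ℚ) * X ^ 7 + C (0 : ℚ) * X ^ 8 + C (4 : ℚ) * X ^ 9 + C (0 : ℚ) * X ^ 10 +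
      C (6 : ℚ) * X ^ 11 + C (0 : ℚ) * X ^ 12 + C (4 : ℚ) * X ^ 13 + C (0 : ℚ) * X ^ 14 + C (2 : ℚ) * X ^ 15) (by compute_degree) (by
    rw [red_xi_sqrtNegOne hζ]
    simp only [map_add, map_mul, map_pow, aeval_C, aeval_X, eq_ratCast]
    push_cast
    linear_combination ((aeval ζ (derivative (cyclotomic 48 ℚ)))⁻¹ * (-ζ^3)) * hΦ)]
  norm_num [coeff_X_pow, coeff_X, coeff_C, coeff_one]

/-- `Tr(ζ′sθ^5) = 0` for `ζ′ = ξ = ζ⁷/Φ₄₈′(ζ)`, `s = √−1 = ζ¹² = i`, `θ = ζ + ζ⁻¹` (Euler evaluation). research route conditional on HC_CM; not a corollary; Q11.4-sentence-2 already refuted in dim ≥ 3. [folklore] -/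
theorem trace_xi_sqrtNegOne_five [IsCyclotomicExtension {48} ℚ K] (hζ : IsPrimitiveRoot ζ 48) :
    Algebra.trace ℚ K ((ζ ^ 7 * (aeval ζ (derivative (cyclotomic 48 ℚ)))⁻¹) * (ζ ^ 12) * (ζ + ζ⁻¹) ^ 5) = 0 := by
  have hΦ := cyc_fortyEight hζ
  rw [trace_of_key hζ (by decide : Nat.totient 48 = 15 + 1) (C (-6 : ℚ) + C (0 : ℚ) * X + C (-10 : ℚ) * X ^ 2 + C (0 : ℚ) * X ^ 3 + C (-10 : ℚ) * X ^ 4 + C (0 : ℚ) * X ^ 5 +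
      C (-5 : ℚ) * X ^ 6 + C (0 : ℚ) * X ^ 7 + C (5 : ℚ) * X ^ 8 + C (0 : ℚ) * X ^ 9 + C (10 : ℚ) * X ^ 10 +
      C (0 : ℚ) * X ^ 11 + C (10 : ℚ) * X ^ 12 + C (0 : ℚ) * X ^ 13 + C (6 : ℚ) * X ^ 14 + C (0 : ℚ) * X ^ 15) (by compute_degree) (by
    rw [red_xi_sqrtNegOne hζ]
    simp only [map_add, map_mul, map_pow, aeval_C, aeval_X, eq_ratCast]
    push_cast
    linear_combination ((aeval ζ (derivative (cyclotomic 48 ℚ)))⁻¹ * (-ζ^3 + ζ^5)) * hΦ)]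
  norm_num [coeff_X_pow, coeff_X, coeff_C, coeff_one]

/-- `Tr(ζ′sθ^6) = 12` for `ζ′ = ξ = ζ⁷/Φ₄₈′(ζ)`, `s = √−1 = ζ¹² = i`, `θ = ζ + ζ⁻¹` (Euler evaluation). research route conditional on HC_CM; not a corollary; Q11.4-sentence-2 already refuted in dim ≥ 3. [folklore] -/
theorem trace_xi_sqrtNegOne_six [IsCyclotomicExtension {48} ℚ K] (hζ : IsPrimitiveRoot ζ 48) :
    Algebra.trace ℚ K ((ζ ^ 7 * (aeval ζ (derivative (cyclotomic 48 ℚ)))⁻¹) * (ζ ^ 12) * (ζ + ζ⁻¹) ^ 6) = 12 := by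
  have hΦ := cyc_fortyEight hζ
  rw [trace_of_key hζ (by decide : Nat.totient 48 = 15 + 1) (C (0 : ℚ) + C (-16 : ℚ) * X + C (0 : ℚ) * X ^ 2 + C (-20 : ℚ) * X ^ 3 + C (0 : ℚ) * X ^ 4 + C (-15 : ℚ) * X ^ 5 +
      C (0 : ℚ) * X ^ 6 + C (-6 : ℚ) * X ^ 7 + C (0 : ℚ) * X ^ 8 + C (15 : ℚ) * X ^ 9 + C (0 : ℚ) * X ^ 10 +
      C (20 : ℚ) * X ^ 11 + C (0 : ℚ) * X ^ 12 + C (16 : ℚ) * X ^ 13 + C (0 : ℚ) * X ^ 14 + C (12 : ℚ) * X ^ 15) (by compute_degree) (by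
    rw [red_xi_sqrtNegOne hζ]
    simp only [map_add, map_mul, map_pow, aeval_C, aeval_X, eq_ratCast]
    push_cast
    linear_combination ((aeval ζ (derivative (cyclotomic 48 ℚ)))⁻¹ * (-ζ^3 - 6 * ζ^5 + ζ^7)) * hΦ)]
  norm_num [coeff_X_pow, coeff_X, coeff_C, coeff_one]

/-- `Tr(ζ′sθ^7) = 0` for `ζ′ = ξ = ζ⁷/Φ₄₈′(ζ)`, `s = √−1 = ζ¹² = i`, `θ = ζ + ζ⁻¹` (Euler evaluation). research route conditional on HC_CM; not a corollary; Q11.4-sentence-2 already refuted in dim ≥ 3. [folklore] -/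
theorem trace_xi_sqrtNegOne_seven [IsCyclotomicExtension {48} ℚ K] (hζ : IsPrimitiveRoot ζ 48) :
    Algebra.trace ℚ K ((ζ ^ 7 * (aeval ζ (derivative (cyclotomic 48 ℚ)))⁻¹) * (ζ ^ 12) * (ζ + ζ⁻¹) ^ 7) = 0 := by
  have hΦ := cyc_fortyEight hζ
  rw [trace_of_key hζ (by decide : Nat.totient 48 = 15 + 1) (C (-28 : ℚ) + C (0 : ℚ) * X + C (-36 : ℚ) * X ^ 2 + C (0 : ℚ) * X ^ 3 + C (-35 : ℚ) * X ^ 4 + C (0 : ℚ) * X ^ 5 +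
      C (-21 : ℚ) * X ^ 6 + C (0 : ℚ) * X ^ 7 + C (21 : ℚ) * X ^ 8 + C (0 : ℚ) * X ^ 9 + C (35 : ℚ) * X ^ 10 +
      C (0 : ℚ) * X ^ 11 + C (36 : ℚ) * X ^ 12 + C (0 : ℚ) * X ^ 13 + C (28 : ℚ) * X ^ 14 + C (0 : ℚ) * X ^ 15) (by compute_degree) (by
    rw [red_xi_sqrtNegOne hζ]
    simp only [map_add, map_mul, map_pow, aeval_C, aeval_X, eq_ratCast]
    push_cast
    linear_combination ((aeval ζ (derivative (cyclotomic 48 ℚ)))⁻¹ * (-ζ^3 - 7 * ζ^5 + 7 * ζ^7 + ζ^9)) * hΦ)]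
  norm_num [coeff_X_pow, coeff_X, coeff_C, coeff_one]

/-- `Tr(ζ′sθ^8) = 56` for `ζ′ = ξ = ζ⁷/Φ₄₈′(ζ)`, `s = √−1 = ζ¹² = i` (trace recurrence from `θ^8`). research route conditional on HC_CM; not a corollary; Q11.4-sentence-2 already refuted in dim ≥ 3. [folklore] -/
theorem trace_xi_sqrtNegOne_eight [IsCyclotomicExtension {48} ℚ K] (hζ : IsPrimitiveRoot ζ 48) :
    Algebra.trace ℚ K ((ζ ^ 7 * (aeval ζ (derivative (cyclotomic 48 ℚ)))⁻¹) * (ζ ^ 12) * (ζ + ζ⁻¹) ^ 8) = 56 := by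
  rw [trace_mul_theta_pow_eight hζ, trace_xi_sqrtNegOne_zero hζ, trace_xi_sqrtNegOne_two hζ, trace_xi_sqrtNegOne_four hζ,
    trace_xi_sqrtNegOne_six hζ]
  norm_num

/-- `Tr(ζ′sθ^9) = 0` for `ζ′ = ξ = ζ⁷/Φ₄₈′(ζ)`, `s = √−1 = ζ¹² = i` (trace recurrence from `θ^8`). research route conditional on HC_CM; not a corollary; Q11.4-sentence-2 already refuted in dim ≥ 3. [folklore] -/
theorem trace_xi_sqrtNegOne_nine [IsCyclotomicExtension {48} ℚ K] (hζ : IsPrimitiveRoot ζ 48) :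
    Algebra.trace ℚ K ((ζ ^ 7 * (aeval ζ (derivative (cyclotomic 48 ℚ)))⁻¹) * (ζ ^ 12) * (ζ + ζ⁻¹) ^ 9) = 0 := by
  rw [trace_mul_theta_pow_nine hζ, trace_xi_sqrtNegOne_one hζ, trace_xi_sqrtNegOne_three hζ, trace_xi_sqrtNegOne_five hζ,
    trace_xi_sqrtNegOne_seven hζ]
  norm_num

/-- `Tr(ζ′sθ^10) = 240` for `ζ′ = ξ = ζ⁷/Φ₄₈′(ζ)`, `s = √−1 = ζ¹² = i` (trace recurrence from `θ^8`). research route conditional on HC_CM; not a corollary; Q11.4-sentence-2 already refuted in dim ≥ 3. [folklore] -/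
theorem trace_xi_sqrtNegOne_ten [IsCyclotomicExtension {48} ℚ K] (hζ : IsPrimitiveRoot ζ 48) :
    Algebra.trace ℚ K ((ζ ^ 7 * (aeval ζ (derivative (cyclotomic 48 ℚ)))⁻¹) * (ζ ^ 12) * (ζ + ζ⁻¹) ^ 10) = 240 := by
  rw [trace_mul_theta_pow_ten hζ, trace_xi_sqrtNegOne_two hζ, trace_xi_sqrtNegOne_four hζ, trace_xi_sqrtNegOne_six hζ,
    trace_xi_sqrtNegOne_eight hζ]
  norm_num

/-- `Tr(ζ′sθ^11) = 0` for `ζ′ = ξ = ζ⁷/Φ₄₈′(ζ)`, `s = √−1 = ζ¹² = i` (trace recurrence from `θ^8`). research route conditional on HC_CM; not a corollary; Q11.4-sentence-2 already refuted in dim ≥ 3. [folklore] -/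
theorem trace_xi_sqrtNegOne_eleven [IsCyclotomicExtension {48} ℚ K] (hζ : IsPrimitiveRoot ζ 48) :
    Algebra.trace ℚ K ((ζ ^ 7 * (aeval ζ (derivative (cyclotomic 48 ℚ)))⁻¹) * (ζ ^ 12) * (ζ + ζ⁻¹) ^ 11) = 0 := by
  rw [trace_mul_theta_pow_eleven hζ, trace_xi_sqrtNegOne_three hζ, trace_xi_sqrtNegOne_five hζ, trace_xi_sqrtNegOne_seven hζ,
    trace_xi_sqrtNegOne_nine hζ]
  norm_num

/-- `Tr(ζ′sθ^12) = 990` for `ζ′ = ξ = ζ⁷/Φ₄₈′(ζ)`, `s = √−1 = ζ¹² = i` (trace recurrence from `θ^8`). research route conditional on HC_CM; not a corollary; Q11.4-sentence-2 already refuted in dim ≥ 3. [folklore] -/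
theorem trace_xi_sqrtNegOne_twelve [IsCyclotomicExtension {48} ℚ K] (hζ : IsPrimitiveRoot ζ 48) :
    Algebra.trace ℚ K ((ζ ^ 7 * (aeval ζ (derivative (cyclotomic 48 ℚ)))⁻¹) * (ζ ^ 12) * (ζ + ζ⁻¹) ^ 12) = 990 := by
  rw [trace_mul_theta_pow_twelve hζ, trace_xi_sqrtNegOne_four hζ, trace_xi_sqrtNegOne_six hζ, trace_xi_sqrtNegOne_eight hζ,
    trace_xi_sqrtNegOne_ten hζ]
  norm_num

/-- `Tr(ζ′sθ^13) = 0` for `ζ′ = ξ = ζ⁷/Φ₄₈′(ζ)`, `s = √−1 = ζ¹² = i` (trace recurrence from `θ^8`). research route conditional on HC_CM; not a corollary; Q11.4-sentence-2 already refuted in dim ≥ 3. [folklore] -/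
theorem trace_xi_sqrtNegOne_thirteen [IsCyclotomicExtension {48} ℚ K] (hζ : IsPrimitiveRoot ζ 48) :
    Algebra.trace ℚ K ((ζ ^ 7 * (aeval ζ (derivative (cyclotomic 48 ℚ)))⁻¹) * (ζ ^ 12) * (ζ + ζ⁻¹) ^ 13) = 0 := by
  rw [trace_mul_theta_pow_thirteen hζ, trace_xi_sqrtNegOne_five hζ, trace_xi_sqrtNegOne_seven hζ, trace_xi_sqrtNegOne_nine hζ,
    trace_xi_sqrtNegOne_eleven hζ]
  norm_num

/-- `Tr(ζ′sθ^14) = 4004` for `ζ′ = ξ = ζ⁷/Φ₄₈′(ζ)`, `s = √−1 = ζ¹² = i` (trace recurrence from `θ^8`). research route conditional on HC_CM; not a corollary; Q11.4-sentence-2 already refuted in dim ≥ 3. [folklore] -/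
theorem trace_xi_sqrtNegOne_fourteen [IsCyclotomicExtension {48} ℚ K] (hζ : IsPrimitiveRoot ζ 48) :
    Algebra.trace ℚ K ((ζ ^ 7 * (aeval ζ (derivative (cyclotomic 48 ℚ)))⁻¹) * (ζ ^ 12) * (ζ + ζ⁻¹) ^ 14) = 4004 := by
  rw [trace_mul_theta_pow_fourteen hζ, trace_xi_sqrtNegOne_six hζ, trace_xi_sqrtNegOne_eight hζ, trace_xi_sqrtNegOne_ten hζ,
    trace_xi_sqrtNegOne_twelve hζ]
  norm_num

/-- **The Gram datum `a` of `(E_ζ′, s)` in the real frame `θ^i` (`i < 8`)** for `ζ′ = ξ = ζ⁷/Φ₄₈′(ζ)` (principal type (1)),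
`s = √−1 = ζ¹² = i`: the integer Hankel matrix `(−Tr(ζ′sθ^{i+j}))ᵢⱼ` (and `b = 0`, part 82 `hb_eq_zero`).
research route conditional on HC_CM; not a corollary; Q11.4-sentence-2 already refuted in dim ≥ 3. [cite: vanGeemen1994HodgeAV, Lemma 5.2 (2)–(3)] -/
theorem realPart_xi_sqrtNegOne [IsCyclotomicExtension {48} ℚ K] [IsCMField K] (hζ : IsPrimitiveRoot ζ 48)
    {x : Fin 8 → K} (hx : ∀ i, x i = (ζ + ζ⁻¹) ^ (i : ℕ)) {a : Matrix (Fin 8) (Fin 8) ℚ}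
    (ha : ∀ i j, a i j = Algebra.trace ℚ K ((ζ ^ 7 * (aeval ζ (derivative (cyclotomic 48 ℚ)))⁻¹) * x i * IsCMField.complexConj K ((ζ ^ 12) * x j))) :
    a = !![0, 0, 0, 0, -2, 0, -12, 0;
        0, 0, 0, -2, 0, -12, 0, -56;
        0, 0, -2, 0, -12, 0, -56, 0;
        0, -2, 0, -12, 0, -56, 0, -240;
        -2, 0, -12, 0, -56, 0, -240, 0;
        0, -12, 0, -56, 0, -240, 0, -990;
        -12, 0, -56, 0, -240, 0, -990, 0;
        0, -56, 0, -240, 0, -990, 0, -4004] := by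
  rw [ha_eq (complexConj_sqrtNegOne hζ) (complexConj_thetaFrame hζ hx) ha]
  ext i j
  simp only [Matrix.of_apply, hx, ← pow_add]
  fin_cases i <;> fin_cases j <;> simp [trace_xi_sqrtNegOne_zero hζ, trace_xi_sqrtNegOne_one hζ, trace_xi_sqrtNegOne_two hζ,
    trace_xi_sqrtNegOne_three hζ, trace_xi_sqrtNegOne_four hζ, trace_xi_sqrtNegOne_five hζ,
    trace_xi_sqrtNegOne_six hζ, trace_xi_sqrtNegOne_seven hζ, trace_xi_sqrtNegOne_eight hζ,
    trace_xi_sqrtNegOne_nine hζ, trace_xi_sqrtNegOne_ten hζ, trace_xi_sqrtNegOne_eleven hζ,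
    trace_xi_sqrtNegOne_twelve hζ, trace_xi_sqrtNegOne_thirteen hζ, trace_xi_sqrtNegOne_fourteen hζ]

/-- **`det a = 256`** for `ζ′ = ξ = ζ⁷/Φ₄₈′(ζ)`, `s = √−1 = ζ¹² = i` (frame `θ^i`, `i < 8`), by an LU certificate `P·a[σ] = U`
(part 119 `det_eq_of_certificate`; `∏ Pᵢᵢ = 1`, `sign σ = -1`, `∏ Uᵢᵢ = -256`). research route conditional on HC_CM; not a corollary; Q11.4-sentence-2 already refuted in dim ≥ 3. [cite: vanGeemen1994HodgeAV, Lemma 5.2 (3)] -/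
theorem det_realPart_xi_sqrtNegOne [IsCyclotomicExtension {48} ℚ K] [IsCMField K] (hζ : IsPrimitiveRoot ζ 48)
    {x : Fin 8 → K} (hx : ∀ i, x i = (ζ + ζ⁻¹) ^ (i : ℕ)) {a : Matrix (Fin 8) (Fin 8) ℚ}
    (ha : ∀ i j, a i j = Algebra.trace ℚ K ((ζ ^ 7 * (aeval ζ (derivative (cyclotomic 48 ℚ)))⁻¹) * x i * IsCMField.complexConj K ((ζ ^ 12) * x j))) :
    a.det = 256 := by
  rw [realPart_xi_sqrtNegOne hζ hx ha]
  exact det_eq_of_certificate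
    !![1, 0, 0, 0, 0, 0, 0, 0;
      0, 1, 0, 0, 0, 0, 0, 0;
      0, 0, 1, 0, 0, 0, 0, 0;
      0, 0, 0, 1, 0, 0, 0, 0;
      0, 0, 0, 0, 1, 0, 0, 0;
      0, -28, 0, 48, 0, 1, 0, 0;
      -6, 0, 8, 0, 0, 0, 1, 0;
      0, -6, 0, 8, 0, 0, 0, 1]
    !![-2, 0, -12, 0, -56, 0, -240, 0;
      0, -2, 0, -12, 0, -56, 0, -240;
      0, 0, -2, 0, -12, 0, -56, 0;
      0, 0, 0, -2, 0, -12, 0, -56;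
      0, 0, 0, 0, -2, 0, -12, 0;
      0, 0, 0, 0, 0, 2, 0, 28;
      0, 0, 0, 0, 0, 0, 2, 0;
      0, 0, 0, 0, 0, 0, 0, 2]
    (Equiv.swap 5 7 * Equiv.swap 1 3 * Equiv.swap 0 4) (-1) _ (by decide +kernel) (by decide +kernel) (by decide +kernel)
    (by decide +kernel) (by decide +kernel) (by decide +kernel)

end Summit.HodgeConjecture.Ring2WeilCoverage.WeilGramLevel48SqrtNegOne

end
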